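import Summits.QuantumFields.YangMills.Theorems.LangevinControlUVOSLegsFromFemtoAndGapStubCollar
import Summits.QuantumFields.YangMills.Theorems.BalabanLadderNTCumulantPolarisationDefs
import HarnessLib

/-!
# Route `ForcedResponseSkewness`, crux `ResponseLocalisation` (stmt-QuantumFields-24869), line «femto-collar»: the third cumulant
# as a two-observable centred moment

Helper file (`--supports stmt-QuantumFields-24869`, lead `ym-line-frs-p1` g3) for the collar transfer
`contactKernel_of_femto` (`Theorems/ForcedResponseSkewnessResponseLocalisationContactOfFemto.lean`):

* `torusK3_eq_torusCum3_yxz` — `torusK3 x y z` is the third cumulant of `(dens y, dens x, dens z)`;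
* `torusK3_eq_integral_centred` — with the NEAR observable `W = (dens x − m_x)(dens z − m_z)` (torus means),
  `κ₃(x,y,z) = ⟨(dens y − ⟨dens y⟩)(W − ⟨W⟩)⟩`, written as the torus integral the two-observable collar bound
  `Femto.abs_integral_two_sub_mean_le` consumes (tree `CumulantPolarisation.torusCum3_eq_cov_centred`);
* `floor_facts` — arithmetic of the cube radius `M = ⌊s/t⌋₊`.

No summit is proved by any of this (leaf R2a `BalabanLadder.NT`, conditional rung line; the YM mass gap is NOT proved).
-/

set_option autoImplicit false

noncomputable section

namespace Summit.QuantumFields.YangMills.Cruxes.ResponseLocalisation.Femto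

open MeasureTheory Filter Topology
open Literature.MathematicalPhysics.QuantumFieldTheory Literature.MathematicalPhysics.QuantumLattice
open Literature.Probability.LatticeModels
open Summit.QuantumFields.YangMills.Cruxes.OSLegsFromFemtoAndGap.DlrCollarTransfer
open Summit.QuantumFields.YangMills.Cruxes.NT.CumulantPolarisation (torusCum3 torusCum3_eq_cov_centred torusE_centred_centred)

/-! ## §1 The third cumulant as a two-observable centred moment -/

section Cumulant

variable {G : Type} [Group G] [TopologicalSpace G] [IsTopologicalGroup G] [CompactSpace G]
  [MeasurableSpace G] [BorelSpace G] (r : LatticeRep G)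

/-- `torusK3 x y z` is the third cumulant of `(dens y, dens x, dens z)` (symmetry of the definition). [folklore] -/
theorem torusK3_eq_torusCum3_yxz (β : ℝ) (L : ℕ) (x y z : Fin 4 → ℤ) :
    torusK3 G r β L x y z = torusCum3 G r β L (dens G r y) (dens G r x) (dens G r z) := by
  simp only [torusK3, torusCum3]
  have e1 : (fun U => dens G r y U * dens G r x U * dens G r z U) = fun U => dens G r x U * dens G r y U * dens G r z U := by
    funext U; ring
  have e2 : (fun U => dens G r y U * dens G r x U) = fun U => dens G r x U * dens G r y U := by
    funext U; ring
  rw [e1, e2]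
  ring

/-- **The third cumulant as a two-observable centred moment**: with the near observable
`W = (dens x − ⟨dens x⟩)(dens z − ⟨dens z⟩)`, `κ₃(x,y,z) = ⟨(dens y − ⟨dens y⟩)(W − ⟨W⟩)⟩`. [folklore] -/
theorem torusK3_eq_integral_centred (β : ℝ) (L : ℕ) (x y z : Fin 4 → ℤ) (mx mz : ℝ)
    (hmx : mx = torusE G r β L (dens G r x)) (hmz : mz = torusE G r β L (dens G r z)) :
    torusK3 G r β L x y z =
      ∫ V, (dens G r y (torusLift (2 * L + 1) V) - ∫ V', dens G r y (torusLift (2 * L + 1) V') ∂(wilsonMeasure r.ρ β)) *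
        ((fun U => (dens G r x U - mx) * (dens G r z U - mz)) (torusLift (2 * L + 1) V) -
          ∫ V', (fun U => (dens G r x U - mx) * (dens G r z U - mz)) (torusLift (2 * L + 1) V')
            ∂(wilsonMeasure r.ρ β)) ∂(wilsonMeasure r.ρ β) := by
  set W : LGConfig 4 G → ℝ := fun U => (dens G r x U - mx) * (dens G r z U - mz) with hW
  have hWc : Continuous W := ((continuous_dens r x).sub continuous_const).mul ((continuous_dens r z).sub continuous_const)
  have hyc : Continuous (dens G r y) := continuous_dens r y
  rw [torusK3_eq_torusCum3_yxz, torusCum3_eq_cov_centred G r β L hyc (continuous_dens r x) (continuous_dens r z),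
    ← hmx, ← hmz]
  have h3 : (fun U => ((dens G r x U - mx) * (dens G r z U - mz)) * dens G r y U) = fun U => dens G r y U * W U := by
    funext U; simp only [hW]; ring
  rw [h3, ← hW]
  have h2 : (∫ V, (dens G r y (torusLift (2 * L + 1) V) -
      ∫ V', dens G r y (torusLift (2 * L + 1) V') ∂(wilsonMeasure r.ρ β)) *
      (W (torusLift (2 * L + 1) V) - ∫ V', W (torusLift (2 * L + 1) V') ∂(wilsonMeasure r.ρ β))
        ∂(wilsonMeasure r.ρ β)) =
      torusE G r β L (fun U => (dens G r y U - torusE G r β L (dens G r y)) * (W U - torusE G r β L W)) := rfl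
  rw [h2, torusE_centred_centred G r β L hyc hWc]
  ring

end Cumulant

/-! ## §2 Arithmetic of the cube radius -/

/-- Arithmetic of the floor `M = ⌊s/t⌋₊` for `0 < t ≤ s/4`: `4 ≤ M`, `M ≤ s/t`, `s/(2t) ≤ M`. [folklore] -/
theorem floor_facts {s t : ℝ} (ht : 0 < t) (hts : t ≤ s / 4) :
    4 ≤ ⌊s / t⌋₊ ∧ (⌊s / t⌋₊ : ℝ) ≤ s / t ∧ s / (2 * t) ≤ (⌊s / t⌋₊ : ℝ) := by
  have hst : 4 ≤ s / t := by rw [le_div_iff₀ ht]; linarith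
  have h0 : 0 ≤ s / t := by linarith
  refine ⟨?_, Nat.floor_le h0, ?_⟩
  · have := Nat.le_floor (n := 4) (a := s / t) (by exact_mod_cast hst)
    exact this
  · have h1 : s / t < (⌊s / t⌋₊ : ℝ) + 1 := Nat.lt_floor_add_one _
    have h2 : s / (2 * t) = (s / t) / 2 := by rw [div_div, mul_comm]
    rw [h2]
    linarith

end Summit.QuantumFields.YangMills.Cruxes.ResponseLocalisation.Femto

end
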